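import Literature.NumberTheory.Sieve.HeathBrownCubicTypeITools
import Literature.NumberTheory.Sieve.HeathBrownCubicFLSequencesA
import HarnessLib

/-!
# Heath-Brown's Type I bound for `𝒜^(K)`: Möbius inversion (5.3) and the singular series (5.4)

Pure-proof file (no definitions, no named facts) in the decomposition of **parity.S18** along
D. R. Heath-Brown, *Primes represented by `x³ + 2y³`*, Acta Math. 186 (2001), 1–84; it belongs to
the deduction (pp. 30–32) of the Type I bound **Lemma 3.2** (`HeathBrown2001_typeI_A` of
`HeathBrownCubicSieveSetup`) from Lemma 5.1, and supplies its two exact (as opposed to estimated)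
ingredients:

* **(5.3), Möbius inversion over the common divisor** (`countA_eq_sum_moebius`):
  `#𝒜^(K)_R = ∑_{d ≥ 1} μ(d) #{x', y' ∈ (X/d, X(1+η)/d] : R ∣ (d)(x' + y'·2^{1/3})}`, a finite sum
  (`d ≤ X(1+η)`; `latticeBox_div_eq_empty`), obtained from `[(x,y) = 1] = ∑_{d ∣ (x,y)} μ(d)`
  (`ite_coprime_eq_sum_moebius`, Mathlib's `μ * ζ = 1`) and the scaling `(x, y) = d·(x', y')` of the
  box (`card_filter_dvd_dvd_eq`, `pairIdeal_mul_left`). Heath-Brown writes the summand as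
  `S(R/(R,d); X/d)`; the reduction `R ∣ (d)·I ↔ R/(R,d) ∣ I` is `dvd_span_mul_iff` (with
  `isCoprime_span_of_eq_sup_mul`: for square-free `R = (R,d)·T`, `T` is coprime to `(d)`).
* **Ideals of square-free norm** (`R ∈ 𝒯r`): they are square-free (`squarefree_of_squarefree_absNorm`)
  and **`N((R, d)) = (N(R), d)`** (`absNorm_sup_span_natCast`), the arithmetic behind (5.4); the
  prime-factor structure of such ideals (prime, pairwise distinct norms) is the tree's `NormSimple`
  API of `HeathBrownCubicFLSequencesA` (`normSimple_of_squarefree_absNorm`).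
* **(5.4), the singular series** (`tsum_moebius_gcd_div_sq`): for `m ≥ 1`,
  `∑_{d ≥ 1} μ(d)(m, d)/d² = (6/π²) ∏_{p ∣ m} (1 + 1/p)^{-1}` — Euler product of the multiplicative
  `d ↦ μ(d)(m,d)/d²` (Mathlib's `EulerProduct.eulerProduct`) against `∏_p (1 − p^{-2}) = 6/π²`
  (`tendsto_prod_primesBelow_one_sub_inv_sq`, from `riemannZeta_eulerProduct` and `riemannZeta_two`);
  with the tree's `rho₂_eq_of_squarefree` (`ρ₂(R) = ∏_{p ∣ N(R)} (1 + 1/p)^{-1}` for `R ∈ 𝒯r`,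
  `HeathBrownCubicFLSequencesA`) this gives **`(6/π²)ρ₂(R)/N(R) = N(R)^{-1} ∑_d μ(d)(N(R), d)/d²`**
  (`mainTerm_eq_tsum`): "which produces the leading terms in Lemma 3.2" (p. 31).

## References

* D. R. Heath-Brown, *Primes represented by `x³ + 2y³`*, Acta Math. 186 (2001), 1–84: §5, (5.3)
  (p. 30), (5.4) (p. 31); Lemma 3.1 (p. 11). [cite: HeathBrownActa2001, §5 (5.3)–(5.4)]

## Mathlib / tree search

Mathlib: `ArithmeticFunction.moebius_mul_coe_zeta`, `ArithmeticFunction.coe_mul_zeta_apply`,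
`ArithmeticFunction.isMultiplicative_moebius`, `ArithmeticFunction.moebius_apply_prime_pow`,
`Nat.Coprime.gcd_mul`, `Finset.sum_comm'`, `Ideal.span_singleton_mul_span_singleton`,
`Ideal.isCoprime_iff_sup_eq`, `IsCoprime.dvd_of_dvd_mul_left`, `Squarefree.dvd_pow_iff_dvd`,
`Nat.prod_primeFactors_of_squarefree`, `Finset.prod_primes_dvd`, `EulerProduct.eulerProduct`,
`riemannZeta_eulerProduct`, `riemannZeta_two`, `Filter.Tendsto.inv₀`, `tsum_eq_sum` (no
`∑ μ(d) gcd(m,d)/d²` or `∏_p (1 − p^{-2}) = 6/π²` over `ℝ` found: searched `primesBelow.*pi`,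
`moebius.*gcd`; the divisor sum `∑_{d∣n} μ(d) = [n=1]` exists in two unrelated tree files and is
re-derived inline from `moebius_mul_coe_zeta`). Tree: `HeathBrownCubicTypeITools` (`latticeBox`,
`latticeCount`, `APairs_eq_filter_latticeBox`), `HeathBrownCubicSieveSetup` (`countA`, `pairIdeal`,
`rho₂`), `HeathBrownCubicFLSequencesA` (`normSimple_of_squarefree_absNorm`,
`NormSimple.exists_prime_dvd_of_dvd_absNorm`, `rho₂_eq_of_squarefree`),
`Literature.NumberTheory.LFunctions.IdealNormCount.absNorm_span_natCast`.
-/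

noncomputable section

open NumberField Finset Filter
open scoped Topology

namespace Literature.NumberTheory.Sieve.CubicSieve

open LFunctions.CubeRootTwoField

/-! ### Möbius inversion over the common divisor of `x, y` ((5.3), p. 30) -/

/-- The coprimality indicator as a Möbius sum: `[(x, y) = 1] = ∑_{d ∣ (x, y)} μ(d)` (Mathlib's
`μ * ζ = 1` evaluated at `(x, y)`; for `x = y = 0` both sides vanish). [folklore] -/
theorem ite_coprime_eq_sum_moebius (x y : ℕ) :
    (if Nat.Coprime x y then (1 : ℤ) else 0) =
      ∑ d ∈ (Nat.gcd x y).divisors, (ArithmeticFunction.moebius d : ℤ) := by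
  have h := congr_arg (fun f : ArithmeticFunction ℤ => f (Nat.gcd x y))
    ArithmeticFunction.moebius_mul_coe_zeta
  simp only [ArithmeticFunction.coe_mul_zeta_apply, ArithmeticFunction.one_apply] at h
  rw [h]

/-- `(dx + dy·2^{1/3}) = (d)·(x + y·2^{1/3})` as ideals. [folklore] -/
theorem pairIdeal_mul_left (d : ℕ) (xy : ℕ × ℕ) :
    pairIdeal (d * xy.1, d * xy.2) = Ideal.span {(d : 𝓞 K)} * pairIdeal xy := by
  have key : (((d * xy.1 : ℕ) : 𝓞 K)) + ((d * xy.2 : ℕ) : 𝓞 K) * θint =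
      (d : 𝓞 K) * ((xy.1 : 𝓞 K) + (xy.2 : 𝓞 K) * θint) := by
    push_cast
    ring
  rw [pairIdeal, pairIdeal, pairElt, pairElt, Ideal.span_singleton_mul_span_singleton, ← key]

/-- Scaling the box: for `d ≥ 1`, `(dx', dy')` lies in the box of side `(X, X(1+η)]` iff `(x', y')`
lies in the box of side `(X/d, X(1+η)/d]`. [folklore] -/
theorem mul_mem_latticeBox_iff {X η : ℝ} {d : ℕ} (hd : 0 < d) (xy : ℕ × ℕ) :
    (d * xy.1, d * xy.2) ∈ latticeBox X η ↔ xy ∈ latticeBox (X / d) η := by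
  have hd' : (0 : ℝ) < d := by exact_mod_cast hd
  simp only [mem_latticeBox_iff, Nat.cast_mul, div_mul_eq_mul_div, div_lt_iff₀' hd',
    le_div_iff₀' hd']

open scoped Classical in
/-- The pairs of the box with `R ∣ (x + y·2^{1/3})` and `d ∣ x`, `d ∣ y` are the pairs `(dx', dy')`
with `(x', y')` in the box scaled by `1/d` and `R ∣ (d)·(x' + y'·2^{1/3})` (`d ≥ 1`).
[cite: HeathBrownActa2001, §5 (5.3)] -/
theorem card_filter_dvd_dvd_eq {X η : ℝ} {d : ℕ} (hd : 0 < d) (R : Ideal (𝓞 K)) :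
    #{xy ∈ latticeBox X η | R ∣ pairIdeal xy ∧ (d ∣ xy.1 ∧ d ∣ xy.2)} =
      #{xy ∈ latticeBox (X / d) η | R ∣ Ideal.span {(d : 𝓞 K)} * pairIdeal xy} := by
  have hinj : Function.Injective fun xy : ℕ × ℕ => (d * xy.1, d * xy.2) := by
    intro a b h
    simp only [Prod.mk.injEq] at h
    exact Prod.ext (Nat.eq_of_mul_eq_mul_left hd h.1) (Nat.eq_of_mul_eq_mul_left hd h.2)
  have himg : ({xy ∈ latticeBox X η | R ∣ pairIdeal xy ∧ (d ∣ xy.1 ∧ d ∣ xy.2)} : Finset (ℕ × ℕ)) =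
      ({xy ∈ latticeBox (X / d) η | R ∣ Ideal.span {(d : 𝓞 K)} * pairIdeal xy}).image
        fun xy : ℕ × ℕ => (d * xy.1, d * xy.2) := by
    ext ⟨x, y⟩
    rw [mem_filter, mem_image]
    constructor
    · rintro ⟨hbox, hR, ⟨x', rfl⟩, ⟨y', rfl⟩⟩
      refine ⟨(x', y'), mem_filter.mpr ⟨(mul_mem_latticeBox_iff hd (x', y')).mp hbox, ?_⟩, rfl⟩
      rwa [← pairIdeal_mul_left]
    · rintro ⟨⟨x', y'⟩, hmem, hxy⟩
      rw [mem_filter] at hmem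
      obtain ⟨hbox, hR⟩ := hmem
      simp only [Prod.mk.injEq] at hxy
      obtain ⟨rfl, rfl⟩ := hxy
      refine ⟨(mul_mem_latticeBox_iff hd (x', y')).mpr hbox, ?_, ⟨x', rfl⟩, ⟨y', rfl⟩⟩
      rwa [← pairIdeal_mul_left] at hR
  rw [himg, card_image_of_injective _ hinj]

open scoped Classical in
/-- **Möbius inversion over the common divisor ((5.3), p. 30)**:
`#𝒜^(K)_R = ∑_{d ≥ 1} μ(d) #{x, y ∈ (X, X(1+η)] : d ∣ x, y, R ∣ x + y·2^{1/3}}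
         = ∑_{d ≥ 1} μ(d) #{x', y' ∈ (X/d, X(1+η)/d] : R ∣ (d)(x' + y'·2^{1/3})}`,
the sum over `d` being finite: `1 ≤ d ≤ D` for any `D ≥ ⌊X(1+η)⌋` (larger `d` give an empty box,
`latticeBox_div_eq_empty`). Heath-Brown writes the summand as `S(R/(R, d); X/d)`: for `R ∈ 𝒯r` the
condition `R ∣ (d)·I` is `R/(R,d) ∣ I` (`dvd_span_mul_iff_of_coprimePart`).
[cite: HeathBrownActa2001, §5 (5.3)] -/
theorem countA_eq_sum_moebius {X η : ℝ} (hX : 0 ≤ X) (R : Ideal (𝓞 K)) {D : ℕ}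
    (hD : ⌊X * (1 + η)⌋₊ ≤ D) :
    (countA X η R : ℤ) =
      ∑ d ∈ Icc 1 D, (ArithmeticFunction.moebius d : ℤ) *
        #{xy ∈ latticeBox (X / d) η | R ∣ Ideal.span {(d : 𝓞 K)} * pairIdeal xy} := by
  -- `#𝒜^(K)_R = ∑_{(x,y) ∈ box, R ∣ I} [gcd(x, y) = 1]`
  set s : Finset (ℕ × ℕ) := {xy ∈ latticeBox X η | R ∣ pairIdeal xy} with hs
  clear_value s
  have hA : APairs X η R = s.filter (fun xy => Nat.Coprime xy.1 xy.2) := by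
    rw [APairs_eq_filter_latticeBox, hs, filter_filter]
    exact filter_congr fun xy _ => and_comm
  have h1 : (countA X η R : ℤ) = ∑ xy ∈ s, if Nat.Coprime xy.1 xy.2 then (1 : ℤ) else 0 := by
    rw [sum_boole, countA, hA]
  have hmem : ∀ xy ∈ s, X < xy.1 ∧ (xy.1 : ℝ) ≤ X * (1 + η) := by
    intro xy hxy
    rw [hs, mem_filter, mem_latticeBox_iff] at hxy
    exact ⟨hxy.1.1, hxy.1.2.1⟩
  have hx0 : ∀ xy ∈ s, xy.1 ≠ 0 := by
    intro xy hxy h0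
    have h := (hmem xy hxy).1
    rw [h0, Nat.cast_zero] at h
    linarith
  -- the interchange of summations
  have hswap : ∀ (xy : ℕ × ℕ) (d : ℕ), xy ∈ s ∧ d ∈ (Nat.gcd xy.1 xy.2).divisors ↔
      xy ∈ s.filter (fun xy => d ∣ xy.1 ∧ d ∣ xy.2) ∧ d ∈ Icc 1 D := by
    intro xy d
    simp only [mem_filter, Nat.mem_divisors, mem_Icc]
    constructor
    · rintro ⟨hxy, hdg, -⟩
      have hdx : d ∣ xy.1 := hdg.trans (Nat.gcd_dvd_left _ _)
      have hdy : d ∣ xy.2 := hdg.trans (Nat.gcd_dvd_right _ _)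
      have hpos : 0 < xy.1 := Nat.pos_of_ne_zero (hx0 xy hxy)
      exact ⟨⟨hxy, hdx, hdy⟩, Nat.pos_of_dvd_of_pos hdx hpos,
        (Nat.le_of_dvd hpos hdx).trans ((Nat.le_floor (hmem xy hxy).2).trans hD)⟩
    · rintro ⟨⟨hxy, hdx, hdy⟩, -, -⟩
      exact ⟨hxy, Nat.dvd_gcd hdx hdy, fun h0 => hx0 xy hxy (Nat.eq_zero_of_gcd_eq_zero_left h0)⟩
  rw [h1]
  simp_rw [ite_coprime_eq_sum_moebius]
  rw [sum_comm' hswap]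
  refine sum_congr rfl fun d hd => ?_
  rw [mem_Icc] at hd
  rw [sum_const, nsmul_eq_mul, mul_comm, hs, filter_filter, card_filter_dvd_dvd_eq hd.1 R]

/-- The terms `d > X(1+η)` vanish: the box `(X/d, X(1+η)/d]` contains no pair of positive integers.
[folklore] -/
theorem latticeBox_div_eq_empty {X η : ℝ} (hX : 0 ≤ X) {d : ℕ} (hd : X * (1 + η) < d) :
    latticeBox (X / d) η = ∅ := by
  ext ⟨x, y⟩
  simp only [mem_latticeBox_iff, Finset.notMem_empty, iff_false, not_and]
  intro hx1 hx2 _ _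
  rcases Nat.eq_zero_or_pos d with rfl | hd0
  · rw [Nat.cast_zero, div_zero, zero_mul] at hx2
    rw [Nat.cast_zero, div_zero] at hx1
    linarith
  · have hd' : (0 : ℝ) < d := by exact_mod_cast hd0
    rw [div_mul_eq_mul_div, le_div_iff₀ hd'] at hx2
    have hx0 : (0 : ℝ) < x := lt_of_le_of_lt (by positivity) hx1
    have hx1' : (1 : ℝ) ≤ x := by exact_mod_cast (show 0 < x by exact_mod_cast hx0)
    nlinarith

/-! ### Ideals of square-free norm: the reduction `R ∣ (d)·I ↔ R/(R,d) ∣ I` and `N((R, d)) = (N(R), d)` -/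

/-- An ideal of square-free norm is square-free (as an element of the monoid of ideals):
`D² ∣ R` gives `N(D)² ∣ N(R)`, so `N(D) = 1`, `D = (1)`. [folklore] -/
theorem squarefree_of_squarefree_absNorm {R : Ideal (𝓞 K)} (h : Squarefree (Ideal.absNorm R)) :
    Squarefree R := by
  intro D hD
  have hN : Ideal.absNorm D * Ideal.absNorm D ∣ Ideal.absNorm R := by
    rw [← map_mul]
    exact Ideal.absNorm_dvd_absNorm_of_le (Ideal.le_of_dvd hD)
  have h1 : IsUnit (Ideal.absNorm D) := h _ hN
  rw [Nat.isUnit_iff, Ideal.absNorm_eq_one_iff] at h1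
  exact Ideal.isUnit_iff.mpr h1

/-- For a square-free ideal `R` written as `R = (R, a)·T` (`(R, a) = R + (a)` the gcd), the cofactor
`T` is coprime to `(a)`: a common divisor `G` of `T` and `(a)` divides `(R, a)` and `T`, so
`G² ∣ R`. [folklore] -/
theorem isCoprime_span_of_eq_sup_mul {R T : Ideal (𝓞 K)} {a : 𝓞 K} (hR : Squarefree R)
    (hRT : R = (R ⊔ Ideal.span {a}) * T) : IsCoprime T (Ideal.span {a}) := by
  rw [Ideal.isCoprime_iff_sup_eq]
  have hGT : T ⊔ Ideal.span {a} ∣ T := Ideal.dvd_iff_le.mpr le_sup_left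
  have hTR : T ∣ R := Dvd.intro_left _ hRT.symm
  have hGS : T ⊔ Ideal.span {a} ∣ R ⊔ Ideal.span {a} :=
    Ideal.dvd_iff_le.mpr (sup_le ((Ideal.le_of_dvd hTR).trans le_sup_left) le_sup_right)
  have hGG : (T ⊔ Ideal.span {a}) * (T ⊔ Ideal.span {a}) ∣ R := by
    rw [hRT]
    exact mul_dvd_mul hGS hGT
  exact Ideal.isUnit_iff.mp (hR _ hGG)

/-- **`R ∣ (a)·I ↔ T ∣ I`** when `R = (R, a)·T` with `T` coprime to `(a)` — Heath-Brown's
`R ∣ d(x' + y'·2^{1/3}) ⟺ R/(R, d) ∣ x' + y'·2^{1/3}` in (5.3). [cite: HeathBrownActa2001, §5 (5.3)] -/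
theorem dvd_span_mul_iff {R T I : Ideal (𝓞 K)} {a : 𝓞 K} (hRT : R = (R ⊔ Ideal.span {a}) * T)
    (hT : IsCoprime T (Ideal.span {a})) : R ∣ Ideal.span {a} * I ↔ T ∣ I := by
  constructor
  · intro h
    exact hT.dvd_of_dvd_mul_left (((Dvd.intro_left _ hRT.symm : T ∣ R)).trans h)
  · intro h
    rw [hRT]
    exact mul_dvd_mul (Ideal.dvd_iff_le.mpr le_sup_right) h

/-- **`N((R, d)) = (N(R), d)`** for an ideal `R` of square-free norm and `d ∈ ℕ`, where
`(R, d) = R + (d)` is the gcd of `R` and `(d)`: `N((R,d))` is a square-free divisor of `N(R)` and of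
`N((d)) = d³`, hence of `(N(R), d)`; conversely each prime `p ∣ (N(R), d)` is the norm of a prime
`P ∣ R` (`NormSimple.exists_prime_dvd_of_dvd_absNorm` of `HeathBrownCubicFLSequencesA`), and
`P ⊇ R + (d)` as `p ∈ P`. This is the arithmetic behind (5.4):
`N(R/(R, d)) = N(R)/(N(R), d)`. [cite: HeathBrownActa2001, §5 (5.4)] -/
theorem absNorm_sup_span_natCast {R : Ideal (𝓞 K)} (hR : Squarefree (Ideal.absNorm R)) (d : ℕ) :
    Ideal.absNorm (R ⊔ Ideal.span {(d : 𝓞 K)}) = Nat.gcd (Ideal.absNorm R) d := by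
  set S := R ⊔ Ideal.span {(d : 𝓞 K)} with hS
  have h1 : Ideal.absNorm S ∣ Ideal.absNorm R := Ideal.absNorm_dvd_absNorm_of_le le_sup_left
  have hSsq : Squarefree (Ideal.absNorm S) := Squarefree.squarefree_of_dvd h1 hR
  apply Nat.dvd_antisymm
  · have h2 : Ideal.absNorm S ∣ d ^ 3 := by
      have h := Ideal.absNorm_dvd_absNorm_of_le (le_sup_right : Ideal.span {(d : 𝓞 K)} ≤ S)
      rwa [Literature.NumberTheory.LFunctions.IdealNormCount.absNorm_span_natCast K d, finrank_K] at h
    rw [hSsq.dvd_pow_iff_dvd three_ne_zero] at h2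
    exact Nat.dvd_gcd h1 h2
  · set g := Nat.gcd (Ideal.absNorm R) d with hg
    have hgsq : Squarefree g := Squarefree.squarefree_of_dvd (Nat.gcd_dvd_left _ _) hR
    rw [← Nat.prod_primeFactors_of_squarefree hgsq]
    refine Finset.prod_primes_dvd _ (fun p hp => Nat.prime_iff.mp (Nat.prime_of_mem_primeFactors hp))
      fun p hp => ?_
    have hpp : p.Prime := Nat.prime_of_mem_primeFactors hp
    have hpg : p ∣ g := Nat.dvd_of_mem_primeFactors hp
    have hR0 : R ≠ ⊥ := by
      rintro rfl
      rw [Ideal.absNorm_bot] at hR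
      exact not_squarefree_zero hR
    obtain ⟨P, -, -, hPR, hNP⟩ := (normSimple_of_squarefree_absNorm hR).exists_prime_dvd_of_dvd_absNorm
      hR0 hpp (hpg.trans (Nat.gcd_dvd_left _ _))
    have hpP : (p : 𝓞 K) ∈ P := by rw [← hNP]; exact Ideal.absNorm_mem P
    have hdP : (d : 𝓞 K) ∈ P := by
      obtain ⟨k, hk⟩ := hpg.trans (Nat.gcd_dvd_right _ _)
      rw [hk, Nat.cast_mul]
      exact P.mul_mem_right _ hpP
    have hSP : S ≤ P := sup_le (Ideal.le_of_dvd hPR) ((Ideal.span_singleton_le_iff_mem _).mpr hdP)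
    rw [← hNP]
    exact Ideal.absNorm_dvd_absNorm_of_le hSP

/-! ### The singular series (5.4): `∑_d μ(d) (m, d)/d² = (6/π²) ∏_{p ∣ m} (1 + 1/p)^{-1}` -/

/-- **`∏_{p < n} (1 − p^{-2}) → 6/π²`** (the Euler product of `ζ(2) = π²/6`, inverted; Mathlib's
`riemannZeta_eulerProduct` at `s = 2` and `riemannZeta_two`). [folklore] -/
theorem tendsto_prod_primesBelow_one_sub_inv_sq :
    Tendsto (fun n : ℕ => ∏ p ∈ Nat.primesBelow n, (1 - ((p : ℝ) ^ 2)⁻¹)) atTop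
      (𝓝 (6 / Real.pi ^ 2)) := by
  have hζ := riemannZeta_eulerProduct (s := 2) (by norm_num)
  rw [riemannZeta_two] at hζ
  have hne : (Real.pi : ℂ) ^ 2 / 6 ≠ 0 :=
    div_ne_zero (pow_ne_zero 2 (Complex.ofReal_ne_zero.mpr Real.pi_ne_zero)) (by norm_num)
  have hinv := hζ.inv₀ hne
  have hcast : ∀ n : ℕ, (∏ p ∈ Nat.primesBelow n, (1 - (p : ℂ) ^ (-2 : ℂ))⁻¹)⁻¹ =
      ((∏ p ∈ Nat.primesBelow n, (1 - ((p : ℝ) ^ 2)⁻¹) : ℝ) : ℂ) := by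
    intro n
    rw [Complex.ofReal_prod, ← Finset.prod_inv_distrib]
    refine Finset.prod_congr rfl fun p _ => ?_
    rw [inv_inv, Complex.cpow_neg, Complex.cpow_two]
    push_cast
    rfl
  have hlim : ((Real.pi : ℂ) ^ 2 / 6)⁻¹ = ((6 / Real.pi ^ 2 : ℝ) : ℂ) := by
    push_cast
    rw [inv_div]
  have h2 : Tendsto (fun n : ℕ => ((∏ p ∈ Nat.primesBelow n, (1 - ((p : ℝ) ^ 2)⁻¹) : ℝ) : ℂ))
      atTop (𝓝 ((6 / Real.pi ^ 2 : ℝ) : ℂ)) := by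
    rw [← hlim]
    exact hinv.congr fun n => hcast n
  have h := (Complex.continuous_re.tendsto _).comp h2
  rw [Complex.ofReal_re] at h
  exact h.congr fun n => by simp only [Function.comp_apply, Complex.ofReal_re]

/-- The summand of the singular series of (5.4): `f_m(d) = μ(d)·(m, d)/d²`. [cite: HeathBrownActa2001, §5 (5.4)] -/
theorem moebius_gcd_div_sq_mul {m a b : ℕ} (hab : Nat.Coprime a b) :
    (ArithmeticFunction.moebius (a * b) : ℝ) * Nat.gcd m (a * b) / ((a * b : ℕ) : ℝ) ^ 2 =
      ((ArithmeticFunction.moebius a : ℝ) * Nat.gcd m a / (a : ℝ) ^ 2) *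
        ((ArithmeticFunction.moebius b : ℝ) * Nat.gcd m b / (b : ℝ) ^ 2) := by
  rw [ArithmeticFunction.isMultiplicative_moebius.map_mul_of_coprime hab, Nat.Coprime.gcd_mul m hab]
  push_cast
  ring

/-- `|μ(d)(m,d)/d²| ≤ m/d²` for `m ≥ 1`. [folklore] -/
theorem norm_moebius_gcd_div_sq_le {m : ℕ} (hm : 0 < m) (d : ℕ) :
    ‖(ArithmeticFunction.moebius d : ℝ) * Nat.gcd m d / (d : ℝ) ^ 2‖ ≤ m * ((d : ℝ) ^ 2)⁻¹ := by
  rw [Real.norm_eq_abs, div_eq_mul_inv, abs_mul, abs_mul]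
  have h1 : |(ArithmeticFunction.moebius d : ℝ)| ≤ 1 := by
    exact_mod_cast ArithmeticFunction.abs_moebius_le_one
  have h2 : |(Nat.gcd m d : ℝ)| ≤ m := by
    rw [Nat.abs_cast]
    exact_mod_cast Nat.gcd_le_left d hm
  have h3 : |((d : ℝ) ^ 2)⁻¹| = ((d : ℝ) ^ 2)⁻¹ := abs_of_nonneg (by positivity)
  rw [h3]
  calc |(ArithmeticFunction.moebius d : ℝ)| * |(Nat.gcd m d : ℝ)| * ((d : ℝ) ^ 2)⁻¹
      ≤ 1 * m * ((d : ℝ) ^ 2)⁻¹ := by gcongr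
    _ = m * ((d : ℝ) ^ 2)⁻¹ := by ring

/-- The local factor of the singular series at a prime `p`: `∑_e f_m(p^e) = 1 − (m, p)/p²`
(`μ(p^e) = 0` for `e ≥ 2`). [folklore] -/
theorem tsum_moebius_gcd_div_sq_prime_pow (m : ℕ) {p : ℕ} (hp : p.Prime) :
    ∑' e : ℕ, (ArithmeticFunction.moebius (p ^ e) : ℝ) * Nat.gcd m (p ^ e) / ((p ^ e : ℕ) : ℝ) ^ 2 =
      1 - Nat.gcd m p / (p : ℝ) ^ 2 := by
  rw [tsum_eq_sum (s := {0, 1})]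
  · rw [Finset.sum_pair zero_ne_one, pow_zero, pow_one, ArithmeticFunction.moebius_apply_one,
      ArithmeticFunction.moebius_apply_prime hp]
    push_cast
    simp
    ring
  · intro e he
    simp only [Finset.mem_insert, Finset.mem_singleton, not_or] at he
    rw [ArithmeticFunction.moebius_apply_prime_pow hp he.1, if_neg he.2]
    simp

/-- **The singular series of (5.4)**: for `m ≥ 1`,
`∑_{d=1}^∞ μ(d) (m, d)/d² = (6/π²) ∏_{p ∣ m} (1 + 1/p)^{-1}` — the Euler product of the
multiplicative `d ↦ μ(d)(m,d)/d²`, whose factor at `p` is `1 − 1/p` if `p ∣ m` and `1 − 1/p²`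
otherwise, against `∏_p (1 − 1/p²) = 6/π²`. (P. 31: "`η²X² ∑_d μ(d) d^{-2} N((R, d))/N(R) =
(η²X²/N(R)) ∏_{p∤N(R)}(1 − 1/p²) ∏_{p∣N(R)}(1 − 1/p) = (6η²X²/(π²N(R))) ∏_{p∣N(R)}(1 + 1/p)^{-1}`,
which produces the leading terms in Lemma 3.2.") [cite: HeathBrownActa2001, §5 (5.4)] -/
theorem tsum_moebius_gcd_div_sq {m : ℕ} (hm : 0 < m) :
    ∑' d : ℕ, (ArithmeticFunction.moebius d : ℝ) * Nat.gcd m d / (d : ℝ) ^ 2 =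
      6 / Real.pi ^ 2 * ∏ p ∈ m.primeFactors, (1 + (p : ℝ)⁻¹)⁻¹ := by
  set f : ℕ → ℝ := fun d => (ArithmeticFunction.moebius d : ℝ) * Nat.gcd m d / (d : ℝ) ^ 2 with hf
  have hf₀ : f 0 = 0 := by simp [hf]
  have hf₁ : f 1 = 1 := by simp [hf]
  have hmul : ∀ {a b : ℕ}, Nat.Coprime a b → f (a * b) = f a * f b := fun hab => by
    simp only [hf]
    exact moebius_gcd_div_sq_mul hab
  have hsum : Summable fun d => ‖f d‖ :=
    Summable.of_nonneg_of_le (fun _ => norm_nonneg _) (norm_moebius_gcd_div_sq_le hm)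
      ((Real.summable_nat_pow_inv.mpr one_lt_two).mul_left (m : ℝ))
  have hE := EulerProduct.eulerProduct hf₁ hmul hsum hf₀
  -- the local factors
  have hloc : ∀ n : ℕ, ∏ p ∈ Nat.primesBelow n, ∑' e : ℕ, f (p ^ e) =
      (∏ p ∈ Nat.primesBelow n, (1 - ((p : ℝ) ^ 2)⁻¹)) *
        ∏ p ∈ (Nat.primesBelow n).filter (· ∣ m), (1 + (p : ℝ)⁻¹)⁻¹ := by
    intro n
    rw [Finset.prod_filter, ← Finset.prod_mul_distrib]
    refine Finset.prod_congr rfl fun p hp => ?_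
    have hpp : p.Prime := Nat.prime_of_mem_primesBelow hp
    have hp0 : (p : ℝ) ≠ 0 := by exact_mod_cast hpp.ne_zero
    have hp1 : (p : ℝ) + 1 ≠ 0 := by positivity
    simp only [hf]
    rw [tsum_moebius_gcd_div_sq_prime_pow m hpp]
    by_cases hpm : p ∣ m
    · rw [if_pos hpm, Nat.gcd_eq_right hpm]
      field_simp
      ring
    · rw [if_neg hpm, (Nat.coprime_comm.mp ((Nat.Prime.coprime_iff_not_dvd hpp).mpr hpm)).gcd_eq_one]
      push_cast
      ring
  -- the second factor is eventually constant
  have hconst : ∀ n : ℕ, m < n → (Nat.primesBelow n).filter (· ∣ m) = m.primeFactors := by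
    intro n hn
    ext p
    simp only [Finset.mem_filter, Nat.mem_primesBelow, Nat.mem_primeFactors]
    constructor
    · rintro ⟨⟨-, hp⟩, hpm⟩
      exact ⟨hp, hpm, hm.ne'⟩
    · rintro ⟨hp, hpm, -⟩
      exact ⟨⟨(Nat.le_of_dvd hm hpm).trans_lt hn, hp⟩, hpm⟩
  have h2 : Tendsto (fun n : ℕ => ∏ p ∈ (Nat.primesBelow n).filter (· ∣ m), (1 + (p : ℝ)⁻¹)⁻¹)
      atTop (𝓝 (∏ p ∈ m.primeFactors, (1 + (p : ℝ)⁻¹)⁻¹)) := by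
    refine tendsto_const_nhds.congr' ?_
    rw [Filter.EventuallyEq, Filter.eventually_atTop]
    exact ⟨m + 1, fun n hn => by rw [hconst n hn]⟩
  have h3 := tendsto_prod_primesBelow_one_sub_inv_sq.mul h2
  simp_rw [← hloc] at h3
  exact tendsto_nhds_unique hE h3

/-! ### The main term of Lemma 3.2 as a singular series -/

/-- **The main term of Lemma 3.2 as a singular series** ((5.4), p. 31): for `R ∈ 𝒯r`,
`(6/π²) ρ₂(R)/N(R) = N(R)^{-1} ∑_{d ≥ 1} μ(d) (N(R), d)/d²` (`= ∑_{d≥1} μ(d) N((R,d))/(d² N(R))` by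
`absNorm_sup_span_natCast`), combining `tsum_moebius_gcd_div_sq` with
`ρ₂(R) = ∏_{p ∣ N(R)} (1 + 1/p)^{-1}` (`rho₂_eq_of_squarefree`, `HeathBrownCubicFLSequencesA`).
[cite: HeathBrownActa2001, §5 (5.4)] -/
theorem mainTerm_eq_tsum {R : Ideal (𝓞 K)} (hR : Squarefree (Ideal.absNorm R)) :
    6 / Real.pi ^ 2 * rho₂ R / Ideal.absNorm R =
      (Ideal.absNorm R : ℝ)⁻¹ *
        ∑' d : ℕ, (ArithmeticFunction.moebius d : ℝ) * Nat.gcd (Ideal.absNorm R) d / (d : ℝ) ^ 2 := by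
  rw [tsum_moebius_gcd_div_sq (Nat.pos_of_ne_zero hR.ne_zero), rho₂_eq_of_squarefree hR]
  ring

end Literature.NumberTheory.Sieve.CubicSieve

end
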